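import Mathlib
import HarnessLib
import Summits.NavierStokesRegularity.NavierStokesRegularity.Theorems.CompletionRelayChainRelayFrontStepIgnitionWakeShells
import Summits.NavierStokesRegularity.NavierStokesRegularity.Theorems.CompletionRelayChainRelayFrontStepIgnitionSigns

/-!
# `CompletionRelayChain` — crux `RelayFrontStep` (24850), LINE `window_v2`, stub `stub_ignition` (Phase II):
  the NEAR-WAKE shell energies on the Phase-II window `[T*, t₁]` (blueprint §2, second bootstrap)

Second bootstrap (four members: old shells `−3, −2, −1` AND old shell `0`), started at `T*` from the
Phase-I values (`near_wake_phaseI`: `1.0524, 0.5892, 0.3187`, joint budget `0.7962`) and the END-BOX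
(`Σᵢ F i 0 T* ≤ 0.145`, `x₀(T*) ∈ [−0.03213, 0.2755]`), on a window `[T*, t₁]` of length `≤ 7/10` on which the
front carrier is non-negative and the trigger is below `0.51` (pre-crossing facts supplied by the clock). Along
the window the old-front carrier obeys `x₀′ = −u₀² + Λ₋₁u₋₁² ± κ₁√F` (row `0` of the relay table), whence
`x₀ ≤ 0.3767` and `x₀ ≥ −0.3178` from the caps; the back-flow into old shell `−1` and the inflow into old shell
`0` are then bounded by the sign-split flux lemmas, the `−2 → −1` flux by the joint budget (`W ≤ 0.84`).
Result (`near_wake_phaseII`): on `[T*, t₁]`, `Σ F(−3) ≤ 1.0684`, `Σ F(−2) ≤ 0.6178`, `Σ F(−1) ≤ 0.3703`,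
`Σ F(0) ≤ 0.1864` — under the `wakeS` profile rescaled by any `a ≥ 9/10` (`2a², a², a²/2, a²/4 ≥ 1.62,
0.81, 0.405, 0.2025`).

No definitions. HONEST FRAMING: MODEL lattice only (Tao 2016 §4 vocabulary); helper for one registered stub of
an open crux, no stub credit; nothing here is a statement about the Navier–Stokes equations.
-/

noncomputable section

-- the summit-side namespace repeats a component by design (D-0017)
set_option linter.dupNamespace false

open Set MeasureTheory intervalIntegral Literature.Analysis.FluidPDE Literature.Analysis.FluidPDE.TaoCascade
open Summit.NavierStokesRegularity.NavierStokesRegularity.Theorems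
open Summit.NavierStokesRegularity.NavierStokesRegularity.Theorems.RelayFrontStep

namespace Summit.NavierStokesRegularity.NavierStokesRegularity.Cruxes.RelayFrontStep.Window2

variable {τ κ₁ κ₂ : ℝ} {α : Fin 4 → Fin 4 → Fin 4 → ℤ × ℤ × ℤ → ℝ}
  {S₀ F₀ B₀ : Fin 4 → ℤ → ℝ} {S F : Fin 4 → ℤ → ℝ → ℝ}

/-! ### The old-front carrier on the window -/

/-- Row `0` of the relay table at the front shell: `quadTerm(x₀) = −u₀² + Λ₋₁u₋₁²`, hence the one-sided bounds
`−u₀² − κ₁√F₀₀ ≤ x₀′ ≤ 0.177·u₋₁² + κ₁√F₀₀`. [this file] -/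
theorem x0_deriv_bounds (h : PseudoFlowOn τ 1 α κ₁ κ₂ S₀ F₀ B₀ S F) (hrows : RelayRows α)
    {s : ℝ} (hs : s ∈ Icc 0 τ) :
    -(S 1 0 s ^ 2) - κ₁ * Real.sqrt (F 0 0 s) ≤ derivWithin (S 0 0) (Icc 0 τ) s ∧
      derivWithin (S 0 0) (Icc 0 τ) s ≤ 177 / 1000 * S 1 (-1) s ^ 2 + κ₁ * Real.sqrt (F 0 0 s) := by
  have hm := h.motion 0 0 s hs
  have hc0 : (1 + 1 : ℝ) ^ ((5 : ℝ) * (((0 : ℤ)) : ℝ) / 2) = 1 := by norm_num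
  have hw0 : (1 + 1 : ℝ) ^ ((2 : ℝ) * (((0 : ℤ)) : ℝ)) = 1 := by norm_num
  have hcm : (1 + 1 : ℝ) ^ ((5 : ℝ) * ((((0 : ℤ)) : ℝ) - 1) / 2) ≤ 177 / 1000 := by
    have e : (1 + 1 : ℝ) ^ ((5 : ℝ) * ((((0 : ℤ)) : ℝ) - 1) / 2) = (2 : ℝ) ^ (-(5 : ℝ) / 2) := by norm_num
    rw [e]; exact two_rpow_neg_five_halves_le
  have hcm0 : 0 ≤ (1 + 1 : ℝ) ^ ((5 : ℝ) * ((((0 : ℤ)) : ℝ) - 1) / 2) := clock_nonneg _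
  rw [hrows.1 S 0 s, hc0, hw0, show (0 - 1 : ℤ) = -1 by norm_num] at hm
  obtain ⟨hlo, hhi⟩ := abs_le.mp hm
  have hsq : 0 ≤ S 1 (-1) s * S 1 (-1) s := mul_self_nonneg _
  have hup : (1 + 1 : ℝ) ^ ((5 : ℝ) * ((((0 : ℤ)) : ℝ) - 1) / 2) * (S 1 (-1) s * S 1 (-1) s) ≤
      177 / 1000 * S 1 (-1) s ^ 2 := by rw [← pow_two]; exact mul_le_mul_of_nonneg_right hcm (by positivity)
  constructor
  · nlinarith [mul_nonneg hcm0 hsq]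
  · nlinarith

/-- **Old-front carrier on the window**: if on `[a,b] ⊆ [0,τ]` `u₀² ≤ U0sq`, `u₋₁² ≤ U1sq`, `√F₀₀ ≤ 1` and
`0 ≤ κ₁`, then `x₀(a) − (U0sq + κ₁)(t−a) ≤ x₀(t) ≤ x₀(a) + (0.177·U1sq + κ₁)(t−a)`. [this file] -/
theorem x0_window_bounds (h : PseudoFlowOn τ 1 α κ₁ κ₂ S₀ F₀ B₀ S F) (hrows : RelayRows α) (hτ : 0 < τ)
    (hκ : 0 ≤ κ₁) {a b U0sq U1sq : ℝ} (ha : 0 ≤ a) (hab : a ≤ b) (hb : b ≤ τ)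
    (hu0 : ∀ s ∈ Icc a b, S 1 0 s ^ 2 ≤ U0sq) (hum1 : ∀ s ∈ Icc a b, S 1 (-1) s ^ 2 ≤ U1sq)
    (hG : ∀ s ∈ Icc a b, Real.sqrt (F 0 0 s) ≤ 1) :
    ∀ t ∈ Icc a b, S 0 0 a - (U0sq + κ₁) * (t - a) ≤ S 0 0 t ∧
      S 0 0 t ≤ S 0 0 a + (177 / 1000 * U1sq + κ₁) * (t - a) := by
  intro t ht
  have hsI : ∀ s ∈ Icc a b, s ∈ Icc 0 τ := fun s hs => ⟨ha.trans hs.1, hs.2.trans hb⟩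
  constructor
  · refine lower_linear_of_derivWithin_ge hτ (h.contDiffOn_S 0 0) ha hab hb (fun s hs => ?_) t ht
    have h1 := (x0_deriv_bounds h hrows (hsI s hs)).1
    have h2 := hu0 s hs
    have h3 : κ₁ * Real.sqrt (F 0 0 s) ≤ κ₁ := by
      have := mul_le_mul_of_nonneg_left (hG s hs) hκ; simpa using this
    linarith
  · have hinc := increment_le_integral_of_derivWithin_le (g := fun _ => 177 / 1000 * U1sq + κ₁) hτ
      (h.contDiffOn_S 0 0) continuousOn_const ha ht.1 (ht.2.trans hb) (fun s hs => by
        have hs' : s ∈ Icc a b := ⟨hs.1, hs.2.trans ht.2⟩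
        have h1 := (x0_deriv_bounds h hrows (hsI s hs')).2
        have h2 := mul_le_mul_of_nonneg_left (hum1 s hs') (by norm_num : (0 : ℝ) ≤ 177 / 1000)
        have h3 : κ₁ * Real.sqrt (F 0 0 s) ≤ κ₁ := by
          have := mul_le_mul_of_nonneg_left (hG s hs') hκ; simpa using this
        linarith)
    rw [intervalIntegral.integral_const, smul_eq_mul] at hinc
    linarith

/-! ### Power of old shell `0` on the window -/

/-- One-sided variant of `power_le_of_fluxes`: `Φ_{k−1} ≤ A`, `−Φ_k ≤ B` ⇒ shell power `≤ A + B`. [this file] -/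
theorem power_le_of_fluxes' (hrows : RelayRows α) (k : ℤ) (s : ℝ) {A B : ℝ}
    (hA : (1 + 1 : ℝ) ^ ((5 : ℝ) * ((k - 1 : ℤ) : ℝ) / 2) * S 1 (k - 1) s *
        (S 1 (k - 1) s * S 0 (k - 1 + 1) s + (1 / 32 : ℝ) * S 2 (k - 1) s * S 1 (k - 1 + 1) s) ≤ A)
    (hB : -((1 + 1 : ℝ) ^ ((5 : ℝ) * (k : ℝ) / 2) * S 1 k s *
        (S 1 k s * S 0 (k + 1) s + (1 / 32 : ℝ) * S 2 k s * S 1 (k + 1) s)) ≤ B) :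
    ∑ i, quadTerm 1 α S i k s * S i k s ≤ A + B := by
  rw [shell_power_eq hrows k s]
  simp only [sub_add_cancel, Int.cast_sub, Int.cast_one] at hA
  linarith

/-- Power of old shell `0` on the window: inflow from `−1` (carrier `x₀ ≤ Xp`, `|u₀| ≤ U0`, `u₋₁² ≤ U1sq`,
`Σ F(−1) ≤ e₁`) and the front out-flow sign (`x₁ ≥ 0`, `|u₁| ≤ U1`, `Σ F(0) ≤ e₀`):
`≤ 0.177(U1sq·Xp + e₁U0/32) + e₀U1/32`. [this file] -/
theorem power_zero_le (h : PseudoFlowOn τ 1 α κ₁ κ₂ S₀ F₀ B₀ S F) (hrows : RelayRows α)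
    {r : ℝ} (hr : r ∈ Icc 0 τ) {Xp U0 U1sq e₁ U1 e₀ : ℝ}
    (hXp : 0 ≤ Xp) (hx0 : S 0 0 r ≤ Xp) (hu0 : |S 1 0 r| ≤ U0) (hum1 : S 1 (-1) r ^ 2 ≤ U1sq)
    (he₁ : ∑ i, F i (-1) r ≤ e₁) (hpos : 0 ≤ U1sq * Xp + e₁ * U0 / 32)
    (hx1 : 0 ≤ S 0 1 r) (hu1 : |S 1 1 r| ≤ U1) (he₀ : ∑ i, F i 0 r ≤ e₀) :
    ∑ i, quadTerm 1 α S i 0 r * S i 0 r ≤ 177 / 1000 * (U1sq * Xp + e₁ * U0 / 32) + e₀ * U1 / 32 := by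
  have hx0' : S 0 (-1 + 1) r ≤ Xp := by rw [show (-1 + 1 : ℤ) = 0 by norm_num]; exact hx0
  have hu0' : |S 1 (-1 + 1) r| ≤ U0 := by rw [show (-1 + 1 : ℤ) = 0 by norm_num]; exact hu0
  have hA := flux_le_pos h hr hXp hx0' hu0' hum1 he₁
  have hA' := hA.trans (mul_le_mul_of_nonneg_right clock_neg_one_le hpos)
  have hA'' : (1 + 1 : ℝ) ^ ((5 : ℝ) * ((0 - 1 : ℤ) : ℝ) / 2) * S 1 (0 - 1) r *
      (S 1 (0 - 1) r * S 0 (0 - 1 + 1) r + (1 / 32 : ℝ) * S 2 (0 - 1) r * S 1 (0 - 1 + 1) r) ≤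
      177 / 1000 * (U1sq * Xp + e₁ * U0 / 32) := by
    rw [show (0 - 1 : ℤ) = -1 by norm_num]; exact hA'
  have hB := neg_flux_front_le h hr hx1 hu1 he₀
  exact power_le_of_fluxes' (S := S) hrows 0 r hA'' hB


/-! ### Phase II: rates under the weak caps, and the bootstrap on `[T*, t₁]` -/

/-- **PHASE-II RATES.** On a window `[T*, t]` of length `≤ 7/10` with the weak caps `Σ F(−3) ≤ 1.122`,
`Σ F(−2) ≤ 0.6732`, `Σ F(−1) ≤ 0.408`, `Σ F(0) ≤ 0.204`, the Phase-I values at `T*`, the END-BOX facts for old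
shell `0`, and the pre-crossing front facts `x₁ ≥ 0`, `|u₁| ≤ 0.51`: `Σ F(−3)(t) ≤ 1.0684`, `Σ F(−2)(t) ≤ 0.6178`,
`Σ F(−1)(t) ≤ 0.3703`, `Σ F(0)(t) ≤ 0.1865`. [cite: Tao2016AveragedNS, §4 Lemma 4.1 (4.8)–(4.10)] -/
theorem near_wake_rates_II (h : PseudoFlowOn τ 1 α κ₁ κ₂ S₀ F₀ B₀ S F) (hτ : 0 < τ) (hrows : RelayRows α)
    (hκ0 : 0 ≤ κ₁) (hκ : κ₁ ≤ 1 / 10 ^ 8) {t : ℝ} (hTt : Tstar ≤ t) (htτ : t ≤ τ) (hlen : t - Tstar ≤ 7 / 10)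
    (hW4 : ∀ s ∈ Icc (0 : ℝ) τ, s ≤ 8 → ∑ i, F i (-4) s ≤ (1 + s / 20) * wakeS (-4))
    (hE3T : ∑ i, F i (-3) Tstar ≤ 2631 / 2500) (hE2T : ∑ i, F i (-2) Tstar ≤ 1473 / 2500)
    (hE1T : ∑ i, F i (-1) Tstar ≤ 3187 / 10000)
    (hWT : ∑ i, F i (-2) Tstar + ∑ i, F i (-1) Tstar ≤ 3981 / 5000) (hE0T : ∑ i, F i 0 Tstar ≤ 29 / 200)
    (hx0T : -(3213 / 100000 : ℝ) ≤ S 0 0 Tstar ∧ S 0 0 Tstar ≤ 2755 / 10000)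
    (hfront : ∀ s ∈ Icc Tstar t, 0 ≤ S 0 1 s ∧ |S 1 1 s| ≤ 51 / 100)
    (h3 : ∀ s ∈ Icc Tstar t, ∑ i, F i (-3) s ≤ 561 / 500) (h2 : ∀ s ∈ Icc Tstar t, ∑ i, F i (-2) s ≤ 1683 / 2500)
    (h1 : ∀ s ∈ Icc Tstar t, ∑ i, F i (-1) s ≤ 51 / 125) (h0 : ∀ s ∈ Icc Tstar t, ∑ i, F i 0 s ≤ 51 / 250) :
    ∑ i, F i (-3) t ≤ 2671 / 2500 ∧ ∑ i, F i (-2) t ≤ 3089 / 5000 ∧ ∑ i, F i (-1) t ≤ 3703 / 10000 ∧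
      ∑ i, F i 0 t ≤ 373 / 2000 := by
  have hT0 := Tstar_nonneg
  have hT8 := Tstar_le_eight
  have ht8 : t ≤ 8 := by unfold Tstar at hlen; unfold Tstar at hT8; linarith
  have hsτ : ∀ s ∈ Icc Tstar t, s ∈ Icc 0 τ := fun s hs => ⟨hT0.trans hs.1, hs.2.trans htτ⟩
  have hs8 : ∀ s ∈ Icc Tstar t, s ≤ 8 := fun s hs => hs.2.trans ht8
  -- amplitude facts on the window
  have hu0sq : ∀ s ∈ Icc Tstar t, S 1 0 s ^ 2 ≤ 51 / 125 := fun s hs =>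
    (shell_sq_le h 1 0 (hsτ s hs)).trans (by linarith [h0 s hs])
  have hu0 : ∀ s ∈ Icc Tstar t, |S 1 0 s| ≤ 639 / 1000 := fun s hs =>
    abs_le_of_sq_le_sq (by linarith [hu0sq s hs]) (by norm_num)
  have hum1 : ∀ s ∈ Icc Tstar t, S 1 (-1) s ^ 2 ≤ 102 / 125 := fun s hs =>
    (shell_sq_le h 1 (-1) (hsτ s hs)).trans (by linarith [h1 s hs])
  have hG : ∀ s ∈ Icc Tstar t, Real.sqrt (F 0 0 s) ≤ 1 := fun s hs => by
    have h1' : F 0 0 s ≤ ∑ j, F j 0 s :=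
      Finset.single_le_sum (f := fun j => F j 0 s) (fun j _ => h.nonneg_F j 0 s (hsτ s hs)) (Finset.mem_univ 0)
    rw [show (1 : ℝ) = Real.sqrt 1 by simp]
    exact Real.sqrt_le_sqrt (by linarith [h0 s hs])
  -- the old-front carrier on the window
  have hx0 : ∀ s ∈ Icc Tstar t, -(3178 / 10000 : ℝ) ≤ S 0 0 s ∧ S 0 0 s ≤ 3767 / 10000 := by
    intro s hs
    have hb := x0_window_bounds h hrows hτ hκ0 hT0 hTt htτ hu0sq hum1 hG s hs
    have hsl : s - Tstar ≤ 7 / 10 := by linarith [hs.2]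
    have hs0 : 0 ≤ s - Tstar := by linarith [hs.1]
    have e1 : (51 / 125 + κ₁) * (s - Tstar) ≤ (51 / 125 + 1 / 10 ^ 8) * (7 / 10) :=
      mul_le_mul (by linarith) hsl hs0 (by positivity)
    have e2 : (177 / 1000 * (102 / 125) + κ₁) * (s - Tstar) ≤ (177 / 1000 * (102 / 125) + 1 / 10 ^ 8) * (7 / 10) :=
      mul_le_mul (by linarith) hsl hs0 (by positivity)
    constructor
    · nlinarith [hb.1, hx0T.1]
    · nlinarith [hb.2, hx0T.2]
  have hBFpos : (0 : ℝ) ≤ 102 / 125 * (3178 / 10000) + 51 / 125 * (639 / 1000) / 32 := by norm_num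
  -- the joint budget on the window: W ≤ 0.84
  have hWII : ∀ s ∈ Icc Tstar t, ∑ i, F i (-2) s + ∑ i, F i (-1) s ≤ 84 / 100 := by
    intro s hs
    have hinc := pseudoFlowOn_two_shell_increment_le_const h hτ (-2) hT0 hs.1 (hsτ s hs).2
      (C := 29 / 2000 + 177 / 1000 * (102 / 125 * (3178 / 10000) + 51 / 125 * (639 / 1000) / 32))
      (fun r hr => by
        have hr' : r ∈ Icc Tstar t := ⟨hr.1, hr.2.trans hs.2⟩
        exact power_pair_le h hrows (hsτ r hr') (h3 r hr') (h2 r hr') (by norm_num)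
          (by linarith [(hx0 r hr').1]) (hu0 r hr') (hum1 r hr') (h1 r hr') hBFpos)
    rw [show (-2 + 1 : ℤ) = -1 by norm_num] at hinc
    have hsl : s - Tstar ≤ 7 / 10 := by linarith [hs.2]
    have hs0 : 0 ≤ s - Tstar := by linarith [hs.1]
    nlinarith
  have hWC : ((84 / 100 : ℝ)) ^ 3 / 864 ≤ (263 / 10000) ^ 2 := by norm_num
  -- pointwise powers
  have hP3 : ∀ r ∈ Icc Tstar t, ∑ i, quadTerm 1 α S i (-3) r * S i (-3) r ≤ 57 / 2500 := fun r hr =>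
    power_neg_three_le h hrows (hsτ r hr) (hs8 r hr) (hW4 r (hsτ r hr) (hs8 r hr)) (h3 r hr) (h2 r hr)
  have hP2 : ∀ r ∈ Icc Tstar t, ∑ i, quadTerm 1 α S i (-2) r * S i (-2) r ≤ 29 / 2000 + 263 / 10000 :=
    fun r hr => power_neg_two_le h hrows (hsτ r hr) (by norm_num) hWC (h3 r hr) (h2 r hr) (hWII r hr)
  have hP1 : ∀ r ∈ Icc Tstar t, ∑ i, quadTerm 1 α S i (-1) r * S i (-1) r ≤
      263 / 10000 + 177 / 1000 * (102 / 125 * (3178 / 10000) + 51 / 125 * (639 / 1000) / 32) :=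
    fun r hr => power_neg_one_le h hrows (hsτ r hr) (by norm_num) hWC (hWII r hr) (by norm_num)
      (by linarith [(hx0 r hr).1]) (hu0 r hr) (hum1 r hr) (h1 r hr) hBFpos
  have hP0 : ∀ r ∈ Icc Tstar t, ∑ i, quadTerm 1 α S i 0 r * S i 0 r ≤
      177 / 1000 * (102 / 125 * (3767 / 10000) + 51 / 125 * (639 / 1000) / 32) + 51 / 250 * (51 / 100) / 32 :=
    fun r hr => power_zero_le h hrows (hsτ r hr) (by norm_num) (hx0 r hr).2 (hu0 r hr) (hum1 r hr) (h1 r hr)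
      (by norm_num) (hfront r hr).1 (hfront r hr).2 (h0 r hr)
  have hI3 := pseudoFlowOn_shell_increment_le_const h hτ (-3) hT0 hTt htτ hP3
  have hI2 := pseudoFlowOn_shell_increment_le_const h hτ (-2) hT0 hTt htτ hP2
  have hI1 := pseudoFlowOn_shell_increment_le_const h hτ (-1) hT0 hTt htτ hP1
  have hI0 := pseudoFlowOn_shell_increment_le_const h hτ 0 hT0 hTt htτ hP0
  have ht0 : 0 ≤ t - Tstar := by linarith
  refine ⟨?_, ?_, ?_, ?_⟩
  · nlinarith
  · nlinarith
  · nlinarith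
  · nlinarith

/-- **THE NEAR WAKE ON THE PHASE-II WINDOW** (second bootstrap, four members): along the pseudo-flow, on a window
`[T*, t₁]` of length `≤ 7/10` on which the front carrier is `≥ 0` and the trigger is `≤ 0.51` in size, started
from the Phase-I values at `T*` and the END-BOX facts for old shell `0`: for every `t ∈ [T*, t₁]`,
`Σ F(−3)(t) ≤ 1.0684`, `Σ F(−2)(t) ≤ 0.6178`, `Σ F(−1)(t) ≤ 0.3703`, `Σ F(0)(t) ≤ 0.1865`.
MODEL lattice; nothing about the Navier–Stokes equations. [cite: Tao2016AveragedNS, §4 Lemma 4.1 (4.8)–(4.10)] -/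
theorem near_wake_phaseII (h : PseudoFlowOn τ 1 α κ₁ κ₂ S₀ F₀ B₀ S F) (hτ : 0 < τ) (hrows : RelayRows α)
    (hκ0 : 0 ≤ κ₁) (hκ : κ₁ ≤ 1 / 10 ^ 8) {t₁ : ℝ} (h1τ : t₁ ≤ τ) (hlen : t₁ - Tstar ≤ 7 / 10)
    (hW4 : ∀ s ∈ Icc (0 : ℝ) τ, s ≤ 8 → ∑ i, F i (-4) s ≤ (1 + s / 20) * wakeS (-4))
    (hE3T : ∑ i, F i (-3) Tstar ≤ 2631 / 2500) (hE2T : ∑ i, F i (-2) Tstar ≤ 1473 / 2500)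
    (hE1T : ∑ i, F i (-1) Tstar ≤ 3187 / 10000)
    (hWT : ∑ i, F i (-2) Tstar + ∑ i, F i (-1) Tstar ≤ 3981 / 5000) (hE0T : ∑ i, F i 0 Tstar ≤ 29 / 200)
    (hx0T : -(3213 / 100000 : ℝ) ≤ S 0 0 Tstar ∧ S 0 0 Tstar ≤ 2755 / 10000)
    (hfront : ∀ s ∈ Icc Tstar t₁, 0 ≤ S 0 1 s ∧ |S 1 1 s| ≤ 51 / 100) :
    ∀ t ∈ Icc Tstar t₁, ∑ i, F i (-3) t ≤ 2671 / 2500 ∧ ∑ i, F i (-2) t ≤ 3089 / 5000 ∧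
      ∑ i, F i (-1) t ≤ 3703 / 10000 ∧ ∑ i, F i 0 t ≤ 373 / 2000 := by
  obtain ⟨M, hM0, hM⟩ := wake_apriori_abs h
  have hT0 := Tstar_nonneg
  let sh : Fin 4 → ℤ := ![-3, -2, -1, 0]
  let p : Fin 4 → ℝ := ![11 / 10, 33 / 50, 2 / 5, 1 / 5]
  have hp : ∀ j, 0 ≤ p j := fun j => by fin_cases j <;> simp [p] <;> norm_num
  have hpmin : ∀ j, 1 / 5 ≤ p j := fun j => by fin_cases j <;> simp [p] <;> norm_num
  have hsh0 : ∀ j, sh j ≤ 0 := fun j => by fin_cases j <;> simp [sh]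
  -- the rates lemma packaged for a window end t ∈ [T*, t₁] under the weak caps on [T*, t]
  have hR : ∀ t ∈ Icc Tstar t₁, (∀ j, ∀ s ∈ Icc Tstar t, ∑ i, F i (sh j) s ≤ 51 / 50 * p j) →
      ∑ i, F i (-3) t ≤ 2671 / 2500 ∧ ∑ i, F i (-2) t ≤ 3089 / 5000 ∧ ∑ i, F i (-1) t ≤ 3703 / 10000 ∧
        ∑ i, F i 0 t ≤ 373 / 2000 := by
    intro t ht hweak
    have h3 : ∀ s ∈ Icc Tstar t, ∑ i, F i (-3) s ≤ 561 / 500 := fun s hs => by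
      have := hweak 0 s hs; simp only [sh, p] at this; simp at this; linarith
    have h2 : ∀ s ∈ Icc Tstar t, ∑ i, F i (-2) s ≤ 1683 / 2500 := fun s hs => by
      have := hweak 1 s hs; simp only [sh, p] at this; simp at this; linarith
    have h1 : ∀ s ∈ Icc Tstar t, ∑ i, F i (-1) s ≤ 51 / 125 := fun s hs => by
      have := hweak 2 s hs; simp only [sh, p] at this; simp at this; linarith
    have h0 : ∀ s ∈ Icc Tstar t, ∑ i, F i 0 s ≤ 51 / 250 := fun s hs => by
      have := hweak 3 s hs; simp only [sh, p] at this; simp at this; linarith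
    exact near_wake_rates_II h hτ hrows hκ0 hκ ht.1 (ht.2.trans h1τ) (by linarith [ht.2]) hW4 hE3T hE2T hE1T
      hWT hE0T hx0T (fun s hs => hfront s ⟨hs.1, hs.2.trans ht.2⟩) h3 h2 h1 h0
  have key := bootstrap_family_oneSided_slack (u := fun j : Fin 4 => fun t' => ∑ i, F i (sh j) (Tstar + t'))
    (p := p) (ψ := fun _ => (1 : ℝ)) (τ := t₁ - Tstar) (L := 15 * M ^ 3) (θ := 51 / 50) (by norm_num)
    hp (by positivity) continuousOn_const (fun _ _ => one_pos)
    (fun j s hs t ht hst => by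
      have hM3 : 0 ≤ 3 * M ^ 3 := by positivity
      have hL : 3 * M ^ 3 ≤ 15 * M ^ 3 * p j := by nlinarith [hpmin j]
      have h1 := pseudoFlowOn_shell_increment_le_const h hτ (sh j) (s := Tstar + s) (t := Tstar + t)
        (by linarith [hs.1]) (by linarith) (by linarith [ht.2]) fun r hr => by
          have hrτ : r ∈ Icc 0 τ := ⟨by linarith [hs.1, hr.1], by linarith [hr.2, ht.2]⟩
          exact wake_shell_crude_rate hrows hM (hsh0 j) hrτ
      have e : Tstar + t - (Tstar + s) = t - s := by ring
      rw [e] at h1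
      exact h1.trans (mul_le_mul_of_nonneg_right hL (by linarith)))
    (fun j => by
      fin_cases j
      · simp only [sh, p]; simp; linarith
      · simp only [sh, p]; simp; linarith
      · simp only [sh, p]; simp; linarith
      · simp only [sh, p]; simp; linarith)
    (fun t' ht' hweak => by
      have ht : Tstar + t' ∈ Icc Tstar t₁ := ⟨by linarith [ht'.1], by linarith [ht'.2]⟩
      have hweak' : ∀ j, ∀ s ∈ Icc Tstar (Tstar + t'), ∑ i, F i (sh j) s ≤ 51 / 50 * p j := by
        intro j s hs
        have := hweak j (s - Tstar) ⟨by linarith [hs.1], by linarith [hs.2]⟩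
        simp only [add_sub_cancel, mul_one] at this
        exact this
      have hres := hR (Tstar + t') ht hweak'
      intro j
      fin_cases j
      · simp only [sh, p]; simp; linarith [hres.1]
      · simp only [sh, p]; simp; linarith [hres.2.1]
      · simp only [sh, p]; simp; linarith [hres.2.2.1]
      · simp only [sh, p]; simp; linarith [hres.2.2.2])
  intro t ht
  refine hR t ht fun j s hs => ?_
  have := key j (s - Tstar) ⟨by linarith [hs.1], by linarith [hs.2, ht.2]⟩
  simp only [add_sub_cancel, one_mul] at this
  have hθ : p j ≤ 51 / 50 * p j := by nlinarith [hp j]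
  exact this.trans hθ

end Summit.NavierStokesRegularity.NavierStokesRegularity.Cruxes.RelayFrontStep.Window2
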